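import Summits.QuantumAdvantage.QuantumAdvantage.Theorems.CubicForrelationNearExactIsExactSixteenSplitBTools
import Summits.QuantumAdvantage.QuantumAdvantage.Theorems.CubicForrelationNearExactIsExactSixteenSplitBudget

/-!
# Crux `CubicForrelation.NearExactIsExact` (stmt-QuantumAdvantage-14043) — n = 16, TWO-SIDED: the split configuration (sB) is not realizable

Certificate seat `b2b-cforr-cert` (gen 6).  HONEST FRAMING: a theorem about cubic Boolean pairs on 16 bits (finite slice `n = 16` of the crux) —
the last of the three split boundary configurations of `Φ = 31/32` (`sb_split_trichotomy`) is excluded; NOT summit progress.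

Configuration (sB): `W_g = 64u`, `d₀ = [u odd]` non-constant affine (`L`/`H`), digit sets `A = C = ∅` and `B = {u ≡ 0 (mod 8)} ⊂ H` with `2¹¹`
points; the residual `τ = u − 4(−1)^f` is `(−1)^{d₁}` on `L`, `±4` on `B`, `0` on `H ∖ B`.
* `B` is the support of the degree-`≤ 5` function `¬d₀ ∧ ¬d₂` (given `A = ∅`) with `2¹¹` ones: an 11-flat `x_B ⊕ V_B`.
* `L`-piece: `d₁ ≡ 0` on `H`, so all periods `V_L` of `d₀` are periods up to sign of `(−1)^{d₁}1_L` (`sp_L_l1`): `Σ|·̂| ≤ 2¹⁶`.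
* `B`-piece `ε = τ/4 = ±1` on `B`: FOUR directions `t₁,…,t₄ ∈ V_L` transversal to `V_B` (`st4_dirs4`, `8·2¹¹ < 2¹⁵`); the general 6-flat sum
  over `x ⊕ ⟨t₁,t₂,t₃,t₄,a,b⟩` (`16 ∣ Σ u`, `16 ∣ 4Σ(−1)^f`) localises (`st4_loc4`) to `4·Σ_{2-flat} ε`, so `ε` is multiplicative on 2-flats
  of `B`, every `a ∈ V_B` is a period up to sign, and `fp_l1_sq_mul_le` gives `Σ|(ε1_B)^| ≤ 2¹⁶`.
* Pairing (`sl_pairing16`): `2²¹ = Σ_y (−1)^g τ̂(y) ≤ 2¹⁶ + 4·2¹⁶`. Contradiction (`sbb_splitB_false`).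

References: J. Ax (1964) / R. J. McEliece (1972); MacWilliams–Sloane (1977) Ch. 13–15; R. O'Donnell (2014) §3.3.  Everything below is proved
from Mathlib and the tree; axioms are the standard three.
-/

set_option linter.dupNamespace false -- D-0017: single-problem summit ⇒ `QuantumAdvantage.QuantumAdvantage` by design

noncomputable section

namespace Summit.QuantumAdvantage.QuantumAdvantage.Theorems.CubicForrelation.NearExactIsExact

open Finset
open Literature.Computability.QuantumComplexity
open Literature.Computability.QuantumComplexity.BuzetChailloux (bxor zeroVec bxor_bxor_cancel_left bxor_zeroVec zeroVec_bxor bxor_comm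
  bxor_self)
open Literature.Computability.QuantumComplexity.DerivativeWalsh (W)

/-- **Configuration (sB) is empty.**  For cubic `f, g : 𝔽₂¹⁶ → 𝔽₂` with `W_g = 64u`, a non-constant parity `[u odd]`, `Φ(f,g) = 31/32`, the
pointwise budget identity of `sb_split_trichotomy`, and digit sets `A = ∅`, `#B = 2¹¹`, `C = ∅`: contradiction. [this work] -/
theorem sbb_splitB_false (f g : (Fin (8 + 8) → Bool) → Bool) (hf : IsDegLeFun 3 f) (hg : IsDegLeFun 3 g)
    (u : (Fin (8 + 8) → Bool) → ℤ) (hu : ∀ x, W (fun y => signOf (g y)) x = (2 : ℝ) ^ 6 * (u x : ℝ))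
    (hodd : ∃ x, Odd (u x)) (heven : ∃ x, ¬ Odd (u x)) (hΦ : forrelation f g = 31 / 32)
    (hpt : ∀ x, (u x - 4 * sZ (f x)) ^ 2 = (if Odd (u x) then 1 else 0) + 4 * (if ¬ Odd (u x) ∧ Odd (u x / 2) then 1 else 0)
      + 16 * (if ¬ Odd (u x) ∧ ¬ Odd (u x / 2) ∧ ¬ Odd (u x / 2 / 2) then 1 else 0)
      + 8 * (if Odd (u x) ∧ (Odd (u x / 2) ↔ Odd (u x / 2 / 2)) then 1 else 0))
    (hA0 : #(univ.filter fun x : Fin (8 + 8) → Bool => ¬ Odd (u x) ∧ Odd (u x / 2)) = 0)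
    (hBc : #(univ.filter fun x : Fin (8 + 8) → Bool => ¬ Odd (u x) ∧ ¬ Odd (u x / 2) ∧ ¬ Odd (u x / 2 / 2)) = 2 ^ 11)
    (hC0 : #(univ.filter fun x : Fin (8 + 8) → Bool => Odd (u x) ∧ (Odd (u x / 2) ↔ Odd (u x / 2 / 2))) = 0) : False := by
  classical
  -- digits
  have hd0 : IsDegLeFun 1 (fun x => decide (Odd (u x))) := sx_digitZero g u hg hu
  have hd1 : IsDegLeFun 2 (fun x => decide (Odd (u x / 2))) := sx_digitOne g u hg hu
  have hd2 : IsDegLeFun 4 (fun x => decide (Odd (u x / 2 / 2))) := sx_digitTwo g u hg hu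
  have hA : ∀ x, ¬ Odd (u x) → ¬ Odd (u x / 2) := by
    intro x hx h2
    exact filter_eq_empty_iff.1 (card_eq_zero.1 hA0) (mem_univ x) ⟨hx, h2⟩
  have hC : ∀ x, Odd (u x) → ¬ (Odd (u x / 2) ↔ Odd (u x / 2 / 2)) := by
    intro x hx h
    exact filter_eq_empty_iff.1 (card_eq_zero.1 hC0) (mem_univ x) ⟨hx, h⟩
  set B := univ.filter (fun x : Fin (8 + 8) → Bool => ¬ Odd (u x) ∧ ¬ Odd (u x / 2) ∧ ¬ Odd (u x / 2 / 2)) with hBdef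
  have hmemB : ∀ x, x ∈ B ↔ ¬ Odd (u x) ∧ ¬ Odd (u x / 2) ∧ ¬ Odd (u x / 2 / 2) := fun x => by simp [hBdef]
  -- the residual
  have hτL : ∀ x, Odd (u x) → u x - 4 * sZ (f x) = sZ (decide (Odd (u x / 2))) := by
    intro x hx
    have h := hpt x
    rw [if_pos hx, if_neg (fun h => h.1 hx), if_neg (fun h => h.1 hx), if_neg (fun h => hC x hx h.2)] at h
    have h1 : (u x - 4 * sZ (f x)) * (u x - 4 * sZ (f x)) = 1 := by rw [← pow_two]; linarith
    exact sp_tau_one (mul_self_eq_one_iff.1 h1)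
  have hτB : ∀ x, x ∈ B → (u x - 4 * sZ (f x)) ^ 2 = 16 := by
    intro x hxB
    have hx := (hmemB x).1 hxB
    have h := hpt x
    rw [if_neg hx.1, if_neg (fun h => hx.2.1 h.2), if_pos hx, if_neg (fun h => hx.1 h.1)] at h
    linarith
  have hτ0 : ∀ x, ¬ Odd (u x) → x ∉ B → u x - 4 * sZ (f x) = 0 := by
    intro x hx hxB
    have h := hpt x
    rw [if_neg hx, if_neg (fun h => hA x hx h.2), if_neg (fun h => hxB ((hmemB x).2 h)), if_neg (fun h => hx h.1)] at h
    have h' : (u x - 4 * sZ (f x)) ^ 2 = 0 := by linarith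
    exact (pow_eq_zero_iff two_ne_zero).1 h'
  -- `B` is an 11-flat
  have hdegB : IsDegLeFun (4 + 1) (fun x => (decide (Odd (u x)) ^^ true) && (decide (Odd (u x / 2 / 2)) ^^ true)) :=
    bb_deg_and (tb_isDegLeFun_xor_const hd0 true) (tb_isDegLeFun_xor_const hd2 true) (by norm_num)
  have hsetB : (univ.filter fun x : Fin (8 + 8) → Bool =>
      ((decide (Odd (u x)) ^^ true) && (decide (Odd (u x / 2 / 2)) ^^ true)) = true) = B := by
    rw [hBdef]
    apply filter_congr
    intro x _
    simp only [Bool.xor_true, Bool.and_eq_true, Bool.not_eq_true', decide_eq_false_iff_not]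
    exact ⟨fun h => ⟨h.1, hA x h.1, h.2⟩, fun h => ⟨h.1, h.2.2⟩⟩
  have hmwB := mw_flat_of_minweight 4 _ hdegB (by rw [hsetB, hBc]; norm_num)
  rw [hsetB] at hmwB
  obtain ⟨h0B, haddB, hcardVB, hcosetB⟩ := hmwB
  set VB := univ.filter (fun a : Fin (8 + 8) → Bool => ∀ x,
    ((decide (Odd (u (bxor x a))) ^^ true) && (decide (Odd (u (bxor x a) / 2 / 2)) ^^ true)) =
      ((decide (Odd (u x)) ^^ true) && (decide (Odd (u x / 2 / 2)) ^^ true))) with hVB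
  rw [hBc] at hcardVB
  obtain ⟨xB, hxB⟩ : B.Nonempty := by rw [← card_pos, hBc]; norm_num
  have hSB : B = VB.image (bxor xB) := hcosetB xB (by
    have h := (hmemB xB).1 hxB
    simp [h.1, h.2.2])
  have hPVB : ∀ x, x ∈ B → ∀ a ∈ VB, bxor x a ∈ B := fun x hx a ha => fl1_coset_vadd haddB hSB hx ha
  -- `L` : periods of `d₀`
  have hfiltL : (univ.filter fun x : Fin (8 + 8) → Bool => decide (Odd (u x)) = true) = univ.filter fun x => Odd (u x) :=
    filter_congr fun x _ => by simp
  have hL15 : #(univ.filter fun x : Fin (8 + 8) → Bool => Odd (u x)) = 2 ^ 15 := sx_card_odd_of_split g u hg hu hodd heven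
  have hd0' : IsDegLeFun (0 + 1) (fun x => decide (Odd (u x))) := hd0
  have hmwL := mw_flat_of_minweight 0 _ hd0' (by rw [hfiltL, hL15]; norm_num)
  obtain ⟨h0L, haddL, hcardVL, -⟩ := hmwL
  rw [hfiltL, hL15] at hcardVL
  set VL := univ.filter (fun a : Fin (8 + 8) → Bool => ∀ x, decide (Odd (u (bxor x a))) = decide (Odd (u x))) with hVL
  have hperL : ∀ a ∈ VL, ∀ x, decide (Odd (u (bxor x a))) = decide (Odd (u x)) := fun a ha => (mem_filter.1 ha).2
  -- `V_B ⊆ V_L`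
  have hVBL : ∀ a ∈ VB, ∀ x, decide (Odd (u (bxor x a))) = decide (Odd (u x)) := by
    intro a ha x
    have hxa : bxor xB a ∈ B := hPVB xB hxB a ha
    have hc := tc_const_of_deg_zero (stub_derivDegree (8 + 8) 0 (fun x => decide (Odd (u x))) a hd0) x xB
    have e1 : decide (Odd (u xB)) = false := decide_eq_false ((hmemB xB).1 hxB).1
    have e2 : decide (Odd (u (bxor xB a))) = false := decide_eq_false ((hmemB _).1 hxa).1
    simp only [e1, e2] at hc
    revert hc; cases decide (Odd (u (bxor x a))) <;> cases decide (Odd (u x)) <;> decide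
  have hVBmemL : ∀ a ∈ VB, a ∈ VL := fun a ha => mem_filter.2 ⟨mem_univ _, hVBL a ha⟩
  -- staying in `H` along `V_L`
  have hH_of : ∀ p, ¬ Odd (u p) → ∀ t ∈ VL, ¬ Odd (u (bxor p t)) := by
    intro p hp t ht hodd'
    have := hperL t ht p
    rw [decide_eq_false hp] at this
    exact absurd hodd' (by simpa using this)
  have hz : ∀ p ∈ B, ∀ t ∈ VL, t ∉ VB → u (bxor p t) - 4 * sZ (f (bxor p t)) = 0 :=
    fun p hp t ht htB => hτ0 _ (hH_of p ((hmemB p).1 hp).1 t ht) (fl1_coset_out h0B haddB hSB hp htB)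
  -- the `B`-piece `ε = u/4 − s`
  set eB : (Fin (8 + 8) → Bool) → ℤ := fun x => u x / 4 - sZ (f x) with heBdef
  have hFe : ∀ p ∈ B, u p - 4 * sZ (f p) = 4 * eB p := by
    intro p hp
    obtain ⟨hp0, hp1, -⟩ := (hmemB p).1 hp
    obtain ⟨k, hk⟩ := Int.not_odd_iff_even.1 hp0
    have hk2 : u p / 2 = k := by rw [hk, show k + k = 2 * k by ring, Int.mul_ediv_cancel_left k (by norm_num : (2 : ℤ) ≠ 0)]
    rw [hk2] at hp1
    obtain ⟨m, hm⟩ := Int.not_odd_iff_even.1 hp1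
    simp only [eB]
    rw [hk, hm, show m + m + (m + m) = 4 * m by ring, Int.mul_ediv_cancel_left m (by norm_num : (4 : ℤ) ≠ 0)]
    ring
  have heB : ∀ p ∈ B, eB p = 1 ∨ eB p = -1 := by
    intro p hp
    have h16 := hτB p hp
    rw [hFe p hp] at h16
    have h1 : eB p * eB p = 1 := by nlinarith
    exact mul_self_eq_one_iff.1 h1
  -- four directions in `V_L` transversal to `V_B`
  obtain ⟨t₁, ht₁L, t₂, ht₂L, t₃, ht₃L, t₄, ht₄L, n1, n2, n21, n3, n31, n32, n321, n4, n41, n42, n421, n43, n431, n432, n4321⟩ :=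
    st4_dirs4 VL VB (by rw [hcardVB, hcardVL]; norm_num)
  -- 2-flat multiplicativity of `ε` on `B`
  have hmul : ∀ x ∈ B, ∀ a ∈ VB, ∀ b ∈ VB, eB (bxor (bxor x b) a) * eB x = eB (bxor x a) * eB (bxor x b) := by
    intro x hx a ha b hb
    have hin : ∀ ε : Fin 2 → Bool, (fun j => x j ^^ decide (Odd #(univ.filter fun i =>
        ε i && (![a, b] : Fin 2 → Fin (8 + 8) → Bool) i j))) ∈ B :=
      fun ε => st4_mem_flatPt2 VB h0B (· ∈ B) hPVB hx ![a, b] (fun i => by fin_cases i <;> assumption) ε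
    have h16 := fs_flat_sum_dvd (e := 4) g u hg hu x ![t₁, t₂, t₃, t₄, a, b] (by norm_num)
    obtain ⟨zf, hzf⟩ := sl_sum_sZ_flat f hf x ![t₁, t₂, t₃, t₄, a, b]
    have hzf' : ∑ ε : Fin 6 → Bool, 4 * sZ (f (fun j => x j ^^ decide (Odd #(univ.filter fun i =>
          ε i && (![t₁, t₂, t₃, t₄, a, b] : Fin 6 → Fin (8 + 8) → Bool) i j)))) = 16 * zf := by
      rw [← mul_sum, hzf]; norm_num; ring
    have h16n : (16 : ℤ) ∣ ∑ ε : Fin 6 → Bool, u (fun j => x j ^^ decide (Odd #(univ.filter fun i =>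
          ε i && (![t₁, t₂, t₃, t₄, a, b] : Fin 6 → Fin (8 + 8) → Bool) i j))) := by
      have e16 : (2 : ℤ) ^ 4 = 16 := by norm_num
      rw [e16] at h16; exact h16
    have h16' : (16 : ℤ) ∣ ∑ ε : Fin 6 → Bool, (u (fun j => x j ^^ decide (Odd #(univ.filter fun i =>
          ε i && (![t₁, t₂, t₃, t₄, a, b] : Fin 6 → Fin (8 + 8) → Bool) i j))) -
        4 * sZ (f (fun j => x j ^^ decide (Odd #(univ.filter fun i =>
          ε i && (![t₁, t₂, t₃, t₄, a, b] : Fin 6 → Fin (8 + 8) → Bool) i j))))) := by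
      rw [sum_sub_distrib, hzf']
      exact dvd_sub h16n (Dvd.intro _ rfl)
    -- the fifteen translates vanish
    have hv : ∀ ε : Fin 2 → Bool, ∀ w ∈ VL, w ∉ VB →
        u (bxor (fun j => x j ^^ decide (Odd #(univ.filter fun i =>
          ε i && (![a, b] : Fin 2 → Fin (8 + 8) → Bool) i j))) w) -
        4 * sZ (f (bxor (fun j => x j ^^ decide (Odd #(univ.filter fun i =>
          ε i && (![a, b] : Fin 2 → Fin (8 + 8) → Bool) i j))) w)) = 0 :=
      fun ε w hw hwB => hz _ (hin ε) w hw hwB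
    have hL2 : ∀ {p q : Fin (8 + 8) → Bool}, p ∈ VL → q ∈ VL → bxor p q ∈ VL := fun hp hq => haddL _ hp _ hq
    have key := st4_loc4 (fun y => u y - 4 * sZ (f y)) x t₁ t₂ t₃ t₄ ![a, b]
      (fun ε => hv ε t₁ ht₁L n1) (fun ε => hv ε t₂ ht₂L n2)
      (fun ε => by rw [iw_bxor_assoc]; exact hv ε _ (hL2 ht₂L ht₁L) n21)
      (fun ε => hv ε t₃ ht₃L n3)
      (fun ε => by rw [iw_bxor_assoc]; exact hv ε _ (hL2 ht₃L ht₁L) n31)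
      (fun ε => by rw [iw_bxor_assoc]; exact hv ε _ (hL2 ht₃L ht₂L) n32)
      (fun ε => by rw [iw_bxor_assoc, iw_bxor_assoc]; exact hv ε _ (hL2 ht₃L (hL2 ht₂L ht₁L)) n321)
      (fun ε => hv ε t₄ ht₄L n4)
      (fun ε => by rw [iw_bxor_assoc]; exact hv ε _ (hL2 ht₄L ht₁L) n41)
      (fun ε => by rw [iw_bxor_assoc]; exact hv ε _ (hL2 ht₄L ht₂L) n42)
      (fun ε => by rw [iw_bxor_assoc, iw_bxor_assoc]; exact hv ε _ (hL2 ht₄L (hL2 ht₂L ht₁L)) n421)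
      (fun ε => by rw [iw_bxor_assoc]; exact hv ε _ (hL2 ht₄L ht₃L) n43)
      (fun ε => by rw [iw_bxor_assoc, iw_bxor_assoc]; exact hv ε _ (hL2 ht₄L (hL2 ht₃L ht₁L)) n431)
      (fun ε => by rw [iw_bxor_assoc, iw_bxor_assoc]; exact hv ε _ (hL2 ht₄L (hL2 ht₃L ht₂L)) n432)
      (fun ε => by rw [iw_bxor_assoc, iw_bxor_assoc, iw_bxor_assoc]; exact hv ε _ (hL2 ht₄L (hL2 ht₃L (hL2 ht₂L ht₁L))) n4321)
    beta_reduce at key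
    rw [key] at h16'
    have e2 := st4_sum2 (fun y => u y - 4 * sZ (f y)) x a b
    beta_reduce at e2
    rw [e2, hFe _ hx, hFe _ (hPVB _ hx _ ha), hFe _ (hPVB _ hx _ hb), hFe _ (hPVB _ (hPVB _ hx _ hb) _ ha)] at h16'
    have h4 : (4 : ℤ) ∣ eB x + eB (bxor x a) + eB (bxor x b) + eB (bxor (bxor x b) a) := by
      obtain ⟨k, hk⟩ := h16'
      exact ⟨k, by linarith⟩
    exact fl_signs_of_four_dvd (heB _ hx) (heB _ (hPVB _ hx _ ha)) (heB _ (hPVB _ hx _ hb))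
      (heB _ (hPVB _ (hPVB _ hx _ hb) _ ha)) h4
  -- periods up to sign of `ε1_B`
  set AB : (Fin (8 + 8) → Bool) → ℝ := fun x => if x ∈ B then (eB x : ℝ) else 0 with hAB
  have hperB : ∀ a ∈ VB, ∃ c : ℝ, (c = 1 ∨ c = -1) ∧ ∀ x, AB (bxor x a) = c * AB x := by
    intro a ha
    refine ⟨((eB (bxor xB a) * eB xB : ℤ) : ℝ), ?_, fun x => ?_⟩
    · rcases heB _ (hPVB _ hxB _ ha) with h1 | h1 <;> rcases heB _ hxB with h2 | h2 <;> rw [h1, h2] <;> norm_num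
    · by_cases hx : x ∈ B
      · have hxa : bxor x a ∈ B := hPVB x hx a ha
        simp only [AB, if_pos hx, if_pos hxa]
        have hb : bxor xB x ∈ VB := by
          have := fl1_coset_diff hSB hx
          exact this
        have hm := hmul xB hxB a ha (bxor xB x) hb
        rw [bxor_bxor_cancel_left] at hm
        have hsq : eB xB * eB xB = 1 := by rcases heB _ hxB with h1 | h1 <;> rw [h1] <;> norm_num
        have : eB (bxor x a) = eB (bxor xB a) * eB xB * eB x := by
          have h' : eB (bxor x a) * eB xB * eB xB = eB (bxor xB a) * eB x * eB xB := by rw [hm]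
          rw [mul_assoc, hsq, mul_one] at h'
          rw [h']; ring
        rw [this]; push_cast; ring
      · have hxa : bxor x a ∉ B := fl1_coset_out' haddB hSB hx ha
        simp only [AB, if_neg hx, if_neg hxa, mul_zero]
  have hBb := fp_l1_sq_mul_le AB B VB (fun x hx => by
      simp only [AB, if_pos hx]; rcases heB x hx with h1 | h1 <;> rw [h1] <;> norm_num) (fun x hx => by simp only [AB, if_neg hx])
    h0B haddB hperB
  rw [hcardVB, hBc] at hBb
  have hYle : ∑ y, |W AB y| ≤ 2 ^ 16 := by
    have hnn : 0 ≤ ∑ y, |W AB y| := sum_nonneg fun y _ => abs_nonneg _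
    push_cast at hBb
    nlinarith
  -- the `L`-piece
  have hqH : ∀ a ∈ VL, ∀ h, decide (Odd (u h)) = false → decide (Odd (u (bxor h a) / 2)) = decide (Odd (u h / 2)) := by
    intro a ha h hh
    have hh' : ¬ Odd (u h) := by simpa using hh
    have hha : ¬ Odd (u (bxor h a)) := hH_of h hh' a ha
    rw [decide_eq_false (hA h hh'), decide_eq_false (hA _ hha)]
  obtain ⟨xH, hxH⟩ := heven
  have hxH' : decide (Odd (u xH)) = false := decide_eq_false hxH
  set AL : (Fin (8 + 8) → Bool) → ℝ := fun x => if decide (Odd (u x)) = true then signOf (decide (Odd (u x / 2))) else 0 with hAL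
  have hL := sp_L_l1 (fun x => decide (Odd (u x))) (fun x => decide (Odd (u x / 2))) hd0 hd1 VL h0L haddL hperL hqH hxH'
  rw [hcardVL, hfiltL, hL15] at hL
  have hXle : ∑ y, |W AL y| ≤ 2 ^ 16 := by
    have hnn : 0 ≤ ∑ y, |W AL y| := sum_nonneg fun y _ => abs_nonneg _
    push_cast at hL
    nlinarith
  -- decomposition of the residual
  have hdecomp : (fun x => (u x : ℝ) - 4 * signOf (f x)) = fun x => AL x + 4 * AB x := by
    funext x
    have e : (u x : ℝ) - 4 * signOf (f x) = (((u x - 4 * sZ (f x) : ℤ)) : ℝ) := by push_cast; rw [tp_sZ_cast]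
    rw [e]
    by_cases hx : Odd (u x)
    · have hxB' : x ∉ B := fun h => ((hmemB x).1 h).1 hx
      simp only [AL, AB, if_pos (decide_eq_true hx), if_neg hxB']
      rw [hτL x hx, tp_sZ_cast]; ring
    · have hdx : ¬ decide (Odd (u x)) = true := by simpa using hx
      by_cases hxB' : x ∈ B
      · simp only [AL, AB, if_neg hdx, if_pos hxB']
        rw [hFe x hxB']; push_cast; ring
      · simp only [AL, AB, if_neg hdx, if_neg hxB']
        rw [hτ0 x hx hxB']; norm_num
  -- pairing
  have hpair := sl_pairing16 f g u hu
  rw [hΦ, hdecomp] at hpair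
  have e2 : ∀ y, signOf (g y) * W (fun x => AL x + 4 * AB x) y =
      signOf (g y) * W AL y + 4 * (signOf (g y) * W AB y) := fun y => by
    rw [sp_W_add, fl1_W_smul]; ring
  rw [sum_congr rfl fun y _ => e2 y, sum_add_distrib, ← mul_sum] at hpair
  have hPL : ∑ y, signOf (g y) * W AL y ≤ ∑ y, |W AL y| := fl1_pairing_le_l1 g (W AL)
  have hPB : ∑ y, signOf (g y) * W AB y ≤ ∑ y, |W AB y| := fl1_pairing_le_l1 g (W AB)
  have h26 : (2 : ℝ) ^ 26 * (1 - 31 / 32) = 2 ^ 21 := by norm_num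
  rw [h26] at hpair
  have _hf := hf
  linarith

end Summit.QuantumAdvantage.QuantumAdvantage.Theorems.CubicForrelation.NearExactIsExact

end
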